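import Summits.AtomisticToContinuum.HydrodynamicLimit.Theorems.AnnealedZeroHorizonMeanFluxClosureCollisionalEnergyCurrentClosure
import Literature.Barriers.AtomisticToContinuum.DiluteRegime
import HarnessLib

/-!
# Stub CE of crux `MeanFluxClosure` (stmt-AtomisticToContinuum-9256), part B: the contact remainder
# of the stub's collisional term is negligible in mean, given the FLUX mean bound

Companion of `AnnealedZeroHorizonMeanFluxClosureCollisionalEnergyCurrentClosure.lean` (part A). At fixed
reduced density `σ` the stub's collisional term is `c W^e_ψ`, `c = (N+1)⁻¹`,
`W^e_ψ = (Φ N).energyTransfer ψ ((Φ N).flow t₁ z) (t₂ − t₁)`; part A wrote it as the CONTACT functional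
`W^{contact}_ψ` (kernel `½ Dψ(x_i)(x_i ⊖ x_j) ΔE_i`) plus a remainder with
`∫ |c Rem| ≤ ¼‖D²ψ‖_∞ σ_N ∫ Q`, `Q = σ_N c 𝒮ᴱ` the FLUX functional. Here: (i) the local-Gibbs form of
that bound in the stub's vocabulary; (ii) with a mean bound `∫ Q ≤ C'` eventually in `N` (the
conclusion of stub FLUX, taken as an ordinary hypothesis on the concrete functionals) the remainder has
mean `≤ δ` eventually in `N`, because `σ_N = σ (N+1)^{-1/3} → 0` (`hsDiameter_tendsto_zero`); (iii) the
collision identity `ΔE_i = ⟪(v_i⁻ + v_j⁻)/2, Δv_i⟫` (pair momentum + energy conservation), which makes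
the contact term the collisional stress `Δv_i ⊗ (x_i ⊖ x_j)` contracted with `V ⊗ ∇ψ` — the
microscopic excess-pressure work `p_coll u·∇ψ` the stub closes on.

References: Spohn 1991 Part I §3.2 (3.8), (3.15).
-/

noncomputable section

namespace Summit.AtomisticToContinuum.HydrodynamicLimit.Theorems

open scoped BigOperators ENNReal Topology InnerProductSpace
open MeasureTheory Set Filter Function
open Literature.MathematicalPhysics.KineticTheory Literature.Analysis.FluidPDE
open Literature.Analysis.FunctionSpaces

namespace CollisionalEnergyCurrentClosure

/-- **At a collision the kinetic-energy jump of particle `i` is the pair's mean pre-collisional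
velocity paired with its momentum jump**: `Δ(|v_i|²/2) = ⟪(v_i⁻ + v_j⁻)/2, Δv_i⟫` (momentum and energy
conservation of the pair; any geometry). [folklore] -/
theorem norm_sq_sub_div_two_eq_inner {d : Type*} [Fintype d] {X : Type*} [TopologicalSpace X]
    [T2Space X] {N : ℕ} {G : Geometry d X} {ε : ℝ} {γ : ℝ → Config N d X}
    (h : IsHardSphereTrajectory G ε N γ) {t : ℝ} {i j : Fin N} (hij : i ≠ j)
    (hc : γ t ∈ contactSet G N ε i j) :
    (‖(γ t i).2‖ ^ 2 - ‖(leftLim γ t i).2‖ ^ 2) / 2 =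
      ⟪(2 : ℝ)⁻¹ • ((leftLim γ t i).2 + (leftLim γ t j).2), (γ t i).2 - (leftLim γ t i).2⟫_ℝ := by
  have hP := h.vel_add_vel_eq_leftLim hij hc
  have hE := h.norm_sq_vel_add_eq_leftLim hij hc
  have hb : (γ t j).2 = (leftLim γ t i).2 + (leftLim γ t j).2 - (γ t i).2 := by
    rw [← hP]; abel
  rw [hb] at hE
  rw [norm_sub_sq_real, norm_add_sq_real, inner_add_left] at hE
  rw [real_inner_smul_left, inner_sub_right, inner_add_left, inner_add_left,
    real_inner_self_eq_norm_sq]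
  linarith [real_inner_comm (leftLim γ t j).2 (leftLim γ t i).2]

/-- **The contact remainder of the stub's collisional term is `O(σ_N)` in mean** (local-Gibbs form
of part A's `integrable_contactRemainder_of_integrable_flux`): for `ψ ∈ C²`, `‖D²ψ‖ ≤ C`,
`0 ≤ σ < 1/2`, if `Q = σ_N c 𝒮ᴱ` is integrable under `localGibbsLaw σ a₀ u₀ θ₀ N Φ` then
`c (W^e_ψ − W^{contact}_ψ)` is integrable with `∫ |c (W^e_ψ − W^{contact}_ψ)| ≤ (C σ_N/4) ∫ Q`. [folklore] -/
theorem integral_abs_contactRemainder_localGibbs_le {σ : ℝ} (hσ : 0 ≤ σ) (hσ2 : σ < 1 / 2)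
    (a₀ θ₀ : T3 → ℝ) (u₀ : T3 → V3) (N : ℕ)
    (Φ : HardSphereFlow (Torus.geometry (Fin 3)) (hsDiameter σ N) (N + 1))
    {ψ : T3 → ℝ} (hψ : Torus.IsContDiff 2 ψ) {C : ℝ}
    (hC : ∀ x, ‖Torus.fderiv (Torus.fderiv ψ) x‖ ≤ C) (t₁ t₂ : ℝ)
    (hQ : Integrable (fun z => hsDiameter σ N * ((N + 1 : ℕ) : ℝ)⁻¹ *
      Φ.collisionalTransferFunctional
        (fun (i _j : Fin (N + 1)) (pre post : Config (N + 1) (Fin 3) T3) =>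
          |‖(post i).2‖ ^ 2 - ‖(pre i).2‖ ^ 2| / 2) (Φ.flow t₁ z) (t₂ - t₁))
      (localGibbsLaw σ a₀ u₀ θ₀ N Φ)) :
    Integrable (fun z => ((N + 1 : ℕ) : ℝ)⁻¹ * (Φ.energyTransfer ψ (Φ.flow t₁ z) (t₂ - t₁) -
        Φ.collisionalTransferFunctional
          (fun (i j : Fin (N + 1)) (pre post : Config (N + 1) (Fin 3) T3) =>
            2⁻¹ * (Torus.fderiv ψ (post i).1
              ((Torus.geometry (Fin 3)).sepVec (post i).1 (post j).1) *
              ((‖(post i).2‖ ^ 2 - ‖(pre i).2‖ ^ 2) / 2))) (Φ.flow t₁ z) (t₂ - t₁)))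
        (localGibbsLaw σ a₀ u₀ θ₀ N Φ) ∧
      ∫ z, |((N + 1 : ℕ) : ℝ)⁻¹ * (Φ.energyTransfer ψ (Φ.flow t₁ z) (t₂ - t₁) -
        Φ.collisionalTransferFunctional
          (fun (i j : Fin (N + 1)) (pre post : Config (N + 1) (Fin 3) T3) =>
            2⁻¹ * (Torus.fderiv ψ (post i).1
              ((Torus.geometry (Fin 3)).sepVec (post i).1 (post j).1) *
              ((‖(post i).2‖ ^ 2 - ‖(pre i).2‖ ^ 2) / 2))) (Φ.flow t₁ z) (t₂ - t₁))|
          ∂localGibbsLaw σ a₀ u₀ θ₀ N Φ ≤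
        C * hsDiameter σ N / 4 * ∫ z, hsDiameter σ N * ((N + 1 : ℕ) : ℝ)⁻¹ *
          Φ.collisionalTransferFunctional
            (fun (i _j : Fin (N + 1)) (pre post : Config (N + 1) (Fin 3) T3) =>
              |‖(post i).2‖ ^ 2 - ‖(pre i).2‖ ^ 2| / 2) (Φ.flow t₁ z) (t₂ - t₁)
          ∂localGibbsLaw σ a₀ u₀ θ₀ N Φ :=
  integrable_contactRemainder_of_integrable_flux Φ
    ((hsDiameter_lt_half hσ hσ2 N).trans_eq (by norm_num)) hψ hC t₁ (t₂ - t₁)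
    (by rw [localGibbsLaw_eq]; exact localGibbsMeasure_absolutelyContinuous σ a₀ u₀ θ₀ N Φ)
    (inv_nonneg.2 (Nat.cast_nonneg _)) hQ

/-- **GLUE toward a reshaped stub CE**: if, eventually in `N`, the FLUX functional `Q_N = σ_N c 𝒮ᴱ` is
integrable with mean `≤ C'` under the local Gibbs laws (conclusion of stub FLUX for the flow family
`Φ`), then for every `δ > 0`, eventually in `N`, the contact remainder of the collisional term
`c (W^e_ψ − W^{contact}_ψ)` is integrable with `∫ |·| ≤ δ` (`σ_N → 0`, `hsDiameter_tendsto_zero`).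
[folklore] -/
theorem eventually_integral_abs_contactRemainder_le {σ : ℝ} (hσ : 0 < σ) (hσ2 : σ < 1 / 2)
    (a₀ θ₀ : T3 → ℝ) (u₀ : T3 → V3)
    (Φ : (N : ℕ) → HardSphereFlow (Torus.geometry (Fin 3)) (hsDiameter σ N) (N + 1))
    {ψ : T3 → ℝ} (hψ : Torus.IsContDiff 2 ψ) (t₁ t₂ : ℝ) {C' : ℝ}
    (hF : ∀ᶠ N in atTop, Integrable (fun z => hsDiameter σ N * ((N + 1 : ℕ) : ℝ)⁻¹ *
        (Φ N).collisionalTransferFunctional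
          (fun (i _j : Fin (N + 1)) (pre post : Config (N + 1) (Fin 3) T3) =>
            |‖(post i).2‖ ^ 2 - ‖(pre i).2‖ ^ 2| / 2) ((Φ N).flow t₁ z) (t₂ - t₁))
        (localGibbsLaw σ a₀ u₀ θ₀ N (Φ N)) ∧
      ∫ z, hsDiameter σ N * ((N + 1 : ℕ) : ℝ)⁻¹ *
        (Φ N).collisionalTransferFunctional
          (fun (i _j : Fin (N + 1)) (pre post : Config (N + 1) (Fin 3) T3) =>
            |‖(post i).2‖ ^ 2 - ‖(pre i).2‖ ^ 2| / 2) ((Φ N).flow t₁ z) (t₂ - t₁)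
        ∂localGibbsLaw σ a₀ u₀ θ₀ N (Φ N) ≤ C')
    {δ : ℝ} (hδ : 0 < δ) :
    ∀ᶠ N in atTop,
      Integrable (fun z => ((N + 1 : ℕ) : ℝ)⁻¹ * ((Φ N).energyTransfer ψ ((Φ N).flow t₁ z) (t₂ - t₁) -
        (Φ N).collisionalTransferFunctional
          (fun (i j : Fin (N + 1)) (pre post : Config (N + 1) (Fin 3) T3) =>
            2⁻¹ * (Torus.fderiv ψ (post i).1
              ((Torus.geometry (Fin 3)).sepVec (post i).1 (post j).1) *
              ((‖(post i).2‖ ^ 2 - ‖(pre i).2‖ ^ 2) / 2))) ((Φ N).flow t₁ z) (t₂ - t₁)))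
        (localGibbsLaw σ a₀ u₀ θ₀ N (Φ N)) ∧
      ∫ z, |((N + 1 : ℕ) : ℝ)⁻¹ * ((Φ N).energyTransfer ψ ((Φ N).flow t₁ z) (t₂ - t₁) -
        (Φ N).collisionalTransferFunctional
          (fun (i j : Fin (N + 1)) (pre post : Config (N + 1) (Fin 3) T3) =>
            2⁻¹ * (Torus.fderiv ψ (post i).1
              ((Torus.geometry (Fin 3)).sepVec (post i).1 (post j).1) *
              ((‖(post i).2‖ ^ 2 - ‖(pre i).2‖ ^ 2) / 2))) ((Φ N).flow t₁ z) (t₂ - t₁))|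
          ∂localGibbsLaw σ a₀ u₀ θ₀ N (Φ N) ≤ δ := by
  obtain ⟨C, hC0, hC⟩ := exists_fderiv_fderiv_le hψ
  set C'' : ℝ := max C' 0 with hC''
  -- `σ_N → 0`, hence eventually `C σ_N C'' / 4 ≤ δ`
  have hsmall : ∀ᶠ N in atTop, C * hsDiameter σ N / 4 * C'' ≤ δ := by
    have ht : Tendsto (fun N : ℕ => C * hsDiameter σ N / 4 * C'') atTop (𝓝 (C * 0 / 4 * C'')) :=
      ((tendsto_const_nhds.mul (Literature.Barriers.AtomisticToContinuum.hsDiameter_tendsto_zero σ)).div_const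
        4).mul_const C''
    rw [mul_zero, zero_div, zero_mul] at ht
    exact (tendsto_order.1 ht).2 δ hδ |>.mono fun N hN => hN.le
  filter_upwards [hF, hsmall] with N hN hNs
  obtain ⟨hQi, hQm⟩ := hN
  obtain ⟨hint, hle⟩ := integral_abs_contactRemainder_localGibbs_le hσ.le hσ2 a₀ θ₀ u₀ N (Φ N) hψ hC
    t₁ t₂ hQi
  refine ⟨hint, hle.trans ?_⟩
  have hε0 : 0 ≤ C * hsDiameter σ N / 4 :=
    div_nonneg (mul_nonneg hC0 (hsDiameter_pos hσ N).le) (by norm_num)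
  calc C * hsDiameter σ N / 4 * _ ≤ C * hsDiameter σ N / 4 * C'' :=
        mul_le_mul_of_nonneg_left (hQm.trans (le_max_left _ _)) hε0
    _ ≤ δ := hNs

end CollisionalEnergyCurrentClosure

/-- **Registered-stub form (CE-rem)** of `eventually_integral_abs_contactRemainder_le`: given a FLUX mean bound
eventually in `N`, the contact remainder of the stub's collisional term has mean `≤ δ` eventually in `N`. [folklore] -/
theorem stub_collisionalEnergyContactRemainder : ∀ (σ : ℝ), 0 < σ → σ < 1 / 2 → ∀ (a₀ θ₀ : Literature.MathematicalPhysics.KineticTheory.T3 → ℝ) (u₀ : Literature.MathematicalPhysics.KineticTheory.T3 → Literature.MathematicalPhysics.KineticTheory.V3) (Φ : (N : ℕ) → Literature.Analysis.FluidPDE.HardSphereFlow (Literature.Analysis.FluidPDE.Torus.geometry (Fin 3)) (Literature.MathematicalPhysics.KineticTheory.hsDiameter σ N) (N + 1)) (ψ : Literature.MathematicalPhysics.KineticTheory.T3 → ℝ), Literature.Analysis.FunctionSpaces.Torus.IsContDiff 2 ψ → ∀ (t₁ t₂ C' : ℝ), (∀ᶠ N in Filter.atTop, MeasureTheory.Integrable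 (fun z => Literature.MathematicalPhysics.KineticTheory.hsDiameter σ N * ((N + 1 : ℕ) : ℝ)⁻¹ * (Φ N).collisionalTransferFunctional (fun (i _j : Fin (N + 1)) (pre post : Literature.Analysis.FluidPDE.Config (N + 1) (Fin 3) Literature.MathematicalPhysics.KineticTheory.T3) => |‖(post i).2‖ ^ 2 - ‖(pre i).2‖ ^ 2| / 2) ((Φ N).flow t₁ z) (t₂ - t₁)) (Literature.MathematicalPhysics.KineticTheory.localGibbsLaw σ a₀ u₀ θ₀ N (Φ N)) ∧ ∫ z, Literature.MathematicalPhysics.KineticTheory.hsDiameter σ N * ((N + 1 : ℕ) : ℝ)⁻¹ * (Φ N).collisionalTransferFunctional (fun (i _j : Fin (N + 1)) (pre post : Literature.Analysis.FluidPDE.Config (N + 1) (Fin 3) Literature.MathematicalPhysics.KineticTheory.T3) => |‖(post i).2‖ ^ 2 - ‖(pre i).2‖ ^ 2| / 2) ((Φ N).flow t₁ z) (t₂ - t₁) ∂Literature.MathematicalPhysics.KineticTheory.localGibbsLaw σ a₀ u₀ θ₀ N (Φ N) ≤ C') → ∀ (δ : ℝ), 0 < δ → ∀ᶠ N in Filter.atTop,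 MeasureTheory.Integrable (fun z => ((N + 1 : ℕ) : ℝ)⁻¹ * ((Φ N).energyTransfer ψ ((Φ N).flow t₁ z) (t₂ - t₁) - (Φ N).collisionalTransferFunctional (fun (i j : Fin (N + 1)) (pre post : Literature.Analysis.FluidPDE.Config (N + 1) (Fin 3) Literature.MathematicalPhysics.KineticTheory.T3) => 2⁻¹ * (Literature.Analysis.FunctionSpaces.Torus.fderiv ψ (post i).1 ((Literature.Analysis.FluidPDE.Torus.geometry (Fin 3)).sepVec (post i).1 (post j).1) * ((‖(post i).2‖ ^ 2 - ‖(pre i).2‖ ^ 2) / 2))) ((Φ N).flow t₁ z) (t₂ - t₁))) (Literature.MathematicalPhysics.KineticTheory.localGibbsLaw σ a₀ u₀ θ₀ N (Φ N)) ∧ ∫ z, |((N + 1 : ℕ) : ℝ)⁻¹ * ((Φ N).energyTransfer ψ ((Φ N).flow t₁ z) (t₂ - t₁) - (Φ N).collisionalTransferFunctional (fun (i j : Fin (N + 1)) (pre post : Literature.Analysis.FluidPDE.Config (N + 1) (Fin 3) Literature.MathematicalPhysics.KineticTheory.T3) => 2⁻¹ * (Literature.Analysis.FunctionSpaces.Torus.fderiv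 ψ (post i).1 ((Literature.Analysis.FluidPDE.Torus.geometry (Fin 3)).sepVec (post i).1 (post j).1) * ((‖(post i).2‖ ^ 2 - ‖(pre i).2‖ ^ 2) / 2))) ((Φ N).flow t₁ z) (t₂ - t₁))| ∂Literature.MathematicalPhysics.KineticTheory.localGibbsLaw σ a₀ u₀ θ₀ N (Φ N) ≤ δ :=
  fun _σ hσ hσ2 a₀ θ₀ u₀ Φ _ψ hψ t₁ t₂ _C' hF _δ hδ =>
    CollisionalEnergyCurrentClosure.eventually_integral_abs_contactRemainder_le hσ hσ2 a₀ θ₀ u₀ Φ hψ t₁ t₂ hF hδ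

end Summit.AtomisticToContinuum.HydrodynamicLimit.Theorems

end
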